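import Summits.KontsevichZagierPeriods.KontsevichZagierPeriods.Theorems.HurwitzMicroSectorsNormalFormPrincipleBoxRigidityDimOne
import Summits.KontsevichZagierPeriods.KontsevichZagierPeriods.Theorems.AbelContractionRealHyperellipticSectorPortRatVanishing

/-!
# Route AbelContraction — `RealHyperellipticSector` (crux stmt-KontsevichZagierPeriods-12475):
# the dimension-certified port, layer 8 — `BoxRigidity` inside dimension one

Helper file of the line `Lines/birth.lean` (stub `stub_bakerAlg`, `--supports` the crux): the port
of `Theorems/HurwitzMicroSectorsNormalFormPrincipleBoxRigidityDimOne.lean` (namespace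
`…NormalFormPrinciple.PiBox.Dlog`) INTO THE BUDGET `KZ.relationsLE 1`: negation of mixed normal
forms (`nfD_neg`), rational representations of dimension `1` / `0` on the unit box are mixed normal
forms in `FormalRep ⧸ relationsLE 1` (`nfD_of_isRational_one`, `nfD_of_isRational_zero`), and
`boxRigidityLE_of_le_one` (registered sub-goal): Conjecture 1 frozen to box-rational representations
of dimensions `m, m' ≤ 1`, concluded INSIDE the budget — `KZ.EquivalentLE 1 N N'` — i.e. the
dimension-`≤ 1` box case of `BakerSectorDimOne` (route DimensionBudget) as well.

The analytic preliminaries (`exists_reduced_of_isRational`, `aeval_fin_zero_eq`, …) are reused from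
the original; the moves are `Port.Dlog.*` (dimension `≤ 1`) and `Budget.congr_mem_relationsLE`.

Sources: M. Kontsevich, D. Zagier, *Periods* (2001), §1.2 Conjecture 1 [KontsevichZagier2001];
A. Baker, *Transcendental Number Theory* (1975), Thm. 2.1. No definitions are introduced.
-/

noncomputable section

open MeasureTheory Set
open scoped Polynomial
open Literature.NumberTheory.Transcendental Literature.NumberTheory.Transcendental.KZ
open Literature.ModelTheory.ExponentialFields (IsSemialgebraic)

namespace Summit.KontsevichZagierPeriods.AbelContraction.RealHyperellipticSector.Port

namespace Dlog

open Summit.KontsevichZagierPeriods.HurwitzMicroSectors.NormalFormPrinciple.PiBox.Dlog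
  (exists_carrierA exists_ptCarrierA exists_angCarrier exists_reduced_of_isRational aeval_fin_zero_eq)

variable {RA : ℝ → ℝ → ℝ → IntegralRep 1} {ZA : ℝ → IntegralRep 0} {RG : ℝ → ℝ → IntegralRep 1}

/-- **Negation of a mixed normal form** is a mixed normal form (negate `r`, the `cⱼ` and the `d_l`).
(inside the budget `relationsLE 1`) [cite: KontsevichZagier2001, §1.2 rule (1)] -/
theorem nfD_neg
    (hR : ∀ a b c, IsAlgebraic ℚ a → IsAlgebraic ℚ b → IsAlgebraic ℚ c → 0 < a →
      (RA a b c).domain = {x | x 0 ∈ Set.Ioo a b} ∧ (RA a b c).integrand = fun x => c / x 0)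
    (hZ : ∀ r, IsAlgebraic ℚ r → (ZA r).domain = univ ∧ (ZA r).integrand = fun _ => r)
    (hRG : ∀ t d, IsAlgebraic ℚ t → IsAlgebraic ℚ d →
      (RG t d).domain = {x | x 0 ∈ Set.Ioo 0 t} ∧ (RG t d).integrand = fun x => d / (1 + x 0 ^ 2))
    {x : FormalRep ⧸ relationsLE 1}
    (hx : ∃ (r : ℝ) (k : ℕ) (u c : Fin k → ℝ) (k' : ℕ) (t d : Fin k' → ℝ), IsAlgebraic ℚ r ∧ (∀ j, 1 < u j) ∧
      (∀ j, IsAlgebraic ℚ (u j)) ∧ (∀ j, IsAlgebraic ℚ (c j)) ∧ (∀ l, 0 ≤ t l) ∧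
      (∀ l, IsAlgebraic ℚ (t l)) ∧ (∀ l, IsAlgebraic ℚ (d l)) ∧
      x = QuotientAddGroup.mk' (relationsLE 1) (of (ZA r)) +
        ∑ j, QuotientAddGroup.mk' (relationsLE 1) (of (RA 1 (u j) (c j))) +
        ∑ l, QuotientAddGroup.mk' (relationsLE 1) (of (RG (t l) (d l)))) :
    ∃ (r : ℝ) (k : ℕ) (u c : Fin k → ℝ) (k' : ℕ) (t d : Fin k' → ℝ), IsAlgebraic ℚ r ∧ (∀ j, 1 < u j) ∧
      (∀ j, IsAlgebraic ℚ (u j)) ∧ (∀ j, IsAlgebraic ℚ (c j)) ∧ (∀ l, 0 ≤ t l) ∧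
      (∀ l, IsAlgebraic ℚ (t l)) ∧ (∀ l, IsAlgebraic ℚ (d l)) ∧
      -x = QuotientAddGroup.mk' (relationsLE 1) (of (ZA r)) +
        ∑ j, QuotientAddGroup.mk' (relationsLE 1) (of (RA 1 (u j) (c j))) +
        ∑ l, QuotientAddGroup.mk' (relationsLE 1) (of (RG (t l) (d l))) := by
  obtain ⟨r, k, u, c, k', t, d, hr, hu1, hu, hc, ht0, ht, hd, rfl⟩ := hx
  refine ⟨-r, k, u, fun j => -c j, k', t, fun l => -d l, hr.neg, hu1, hu, fun j => (hc j).neg, ht0, ht,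
    fun l => (hd l).neg, ?_⟩
  have hpt : QuotientAddGroup.mk' (relationsLE 1) (of (ZA (-r))) = -QuotientAddGroup.mk' (relationsLE 1) (of (ZA r)) := by
    have h := pt_add_mem_relationsLE (r := r) (r' := -r) (ZA 0) (ZA r) (ZA (-r))
      (hZ 0 isAlgebraic_zero).1 (hZ _ hr).1 (hZ _ hr.neg).1 (by rw [(hZ 0 isAlgebraic_zero).2, add_neg_cancel])
      (hZ _ hr).2 (hZ _ hr.neg).2
    have h0 : QuotientAddGroup.mk' (relationsLE 1) (of (ZA 0)) = 0 :=
      (QuotientAddGroup.eq_zero_iff _).mpr (pt_zero_mem_relationsLE (ZA 0) (hZ 0 isAlgebraic_zero).2)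
    rw [← QuotientAddGroup.eq_zero_iff] at h
    change QuotientAddGroup.mk' (relationsLE 1) _ = 0 at h
    rw [map_sub, map_sub, h0, zero_sub, sub_eq_zero] at h
    exact h.symm
  rw [hpt, neg_add, neg_add, ← Finset.sum_neg_distrib, ← Finset.sum_neg_distrib]
  congr 1
  · congr 1
    exact Finset.sum_congr rfl fun j _ => (carrierA_neg_eq hR (hu j) (hc j)).symm
  · exact Finset.sum_congr rfl fun l _ => (ang_neg_eq hRG (ht l) (hd l)).symm

/-- **A rational representation on the open unit slab is a mixed normal form.**
(inside the budget `relationsLE 1`) [cite: KontsevichZagier2001, §1.2] -/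
theorem nfD_of_isRational_one
    (hR : ∀ a b c, IsAlgebraic ℚ a → IsAlgebraic ℚ b → IsAlgebraic ℚ c → 0 < a →
      (RA a b c).domain = {x | x 0 ∈ Set.Ioo a b} ∧ (RA a b c).integrand = fun x => c / x 0)
    (hZ : ∀ r, IsAlgebraic ℚ r → (ZA r).domain = univ ∧ (ZA r).integrand = fun _ => r)
    (hRG : ∀ t d, IsAlgebraic ℚ t → IsAlgebraic ℚ d →
      (RG t d).domain = {x | x 0 ∈ Set.Ioo 0 t} ∧ (RG t d).integrand = fun x => d / (1 + x 0 ^ 2))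
    (N : IntegralRep 1) (hNd : N.domain = {x | x 0 ∈ Set.Ioo (0:ℝ) 1}) (hN : N.IsRational) :
    ∃ (r : ℝ) (k : ℕ) (u c : Fin k → ℝ) (k' : ℕ) (t d : Fin k' → ℝ), IsAlgebraic ℚ r ∧ (∀ j, 1 < u j) ∧
      (∀ j, IsAlgebraic ℚ (u j)) ∧ (∀ j, IsAlgebraic ℚ (c j)) ∧ (∀ l, 0 ≤ t l) ∧
      (∀ l, IsAlgebraic ℚ (t l)) ∧ (∀ l, IsAlgebraic ℚ (d l)) ∧
      QuotientAddGroup.mk' (relationsLE 1) (of N) = QuotientAddGroup.mk' (relationsLE 1) (of (ZA r)) +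
        ∑ j, QuotientAddGroup.mk' (relationsLE 1) (of (RA 1 (u j) (c j))) +
        ∑ l, QuotientAddGroup.mk' (relationsLE 1) (of (RG (t l) (d l))) := by
  obtain ⟨p, q, hq, hq01, hNi⟩ := exists_reduced_of_isRational N hNd hN
  set K := algebraicClosure ℚ ℝ
  have hqK0 : q.map (algebraMap ℚ K) ≠ 0 := (Polynomial.map_ne_zero_iff (algebraMap ℚ K).injective).mpr hq
  have haevq : ∀ t : ℝ, (Polynomial.aeval t (q.map (algebraMap ℚ K)) : ℝ) = Polynomial.aeval t q :=
    fun t => Polynomial.aeval_map_algebraMap K t q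
  have haevp : ∀ t : ℝ, (Polynomial.aeval t (p.map (algebraMap ℚ K)) : ℝ) = Polynomial.aeval t p :=
    fun t => Polynomial.aeval_map_algebraMap K t p
  exact nfD_of_dvd hR hZ hRG hq _ (p.map (algebraMap ℚ K)) (q.map (algebraMap ℚ K)) N hqK0 le_rfl dvd_rfl
    (fun t ht => by rw [haevq]; exact hq01 t ht) hNd
    (fun x hx => by
      rw [hNi hx]
      show (Polynomial.aeval (x 0) p : ℝ) / Polynomial.aeval (x 0) q =
        Polynomial.aeval (x 0) (p.map (algebraMap ℚ K)) / Polynomial.aeval (x 0) (q.map (algebraMap ℚ K))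
      rw [haevp, haevq])

/-- **A rational representation of dimension zero is a rational point**, a mixed normal form.
(inside the budget `relationsLE 1`) [cite: KontsevichZagier2001, §1.2] -/
theorem nfD_of_isRational_zero
    (hZ : ∀ r, IsAlgebraic ℚ r → (ZA r).domain = univ ∧ (ZA r).integrand = fun _ => r)
    (N : IntegralRep 0) (hNd : N.domain = univ) (hN : N.IsRational) :
    ∃ (r : ℝ) (k : ℕ) (u c : Fin k → ℝ) (k' : ℕ) (t d : Fin k' → ℝ), IsAlgebraic ℚ r ∧ (∀ j, 1 < u j) ∧
      (∀ j, IsAlgebraic ℚ (u j)) ∧ (∀ j, IsAlgebraic ℚ (c j)) ∧ (∀ l, 0 ≤ t l) ∧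
      (∀ l, IsAlgebraic ℚ (t l)) ∧ (∀ l, IsAlgebraic ℚ (d l)) ∧
      QuotientAddGroup.mk' (relationsLE 1) (of N) = QuotientAddGroup.mk' (relationsLE 1) (of (ZA r)) +
        ∑ j, QuotientAddGroup.mk' (relationsLE 1) (of (RA 1 (u j) (c j))) +
        ∑ l, QuotientAddGroup.mk' (relationsLE 1) (of (RG (t l) (d l))) := by
  obtain ⟨pm, qm, _, hEq⟩ := hN
  set r₀ : ℝ := ((pm.coeff 0 : ℚ) : ℝ) / ((qm.coeff 0 : ℚ) : ℝ) with hr₀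
  have hr₀A : IsAlgebraic ℚ r₀ := by
    rw [hr₀, div_eq_mul_inv]
    exact (isAlgebraic_algebraMap (R := ℚ) (A := ℝ) (pm.coeff 0)).mul
      (isAlgebraic_algebraMap (R := ℚ) (A := ℝ) (qm.coeff 0)).inv
  have hNi : EqOn N.integrand (fun _ => r₀) N.domain := by
    intro x hx; rw [hEq hx]; show MvPolynomial.aeval x pm / MvPolynomial.aeval x qm = r₀
    rw [aeval_fin_zero_eq, aeval_fin_zero_eq]
  have h := Budget.congr_mem_relationsLE zero_le_one (r := N) (r' := ZA r₀) (by rw [(hZ r₀ hr₀A).1, hNd])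
    (fun x hx => by rw [hNi hx, (hZ r₀ hr₀A).2])
  rw [← QuotientAddGroup.eq_zero_iff] at h
  change QuotientAddGroup.mk' (relationsLE 1) _ = 0 at h
  rw [map_sub, sub_eq_zero] at h
  rw [h]
  exact nfD_pt hZ hr₀A (ZA r₀) (hZ r₀ hr₀A).1 (hZ r₀ hr₀A).2

/-! ## Box rigidity in dimensions `≤ 1` -/

/-- **`BoxRigidity` in dimensions `m, m' ≤ 1`** — the literal instance of the registered stub
`stub_boxRigidity` (Conjecture 1 frozen to box-rational representations) for boxes of dimension at
most one, INSIDE THE BUDGET `relationsLE 1` (registered sub-goal of crux stmt-KontsevichZagierPeriods-12475,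
port of `PiBox.Dlog.boxRigidity_of_le_one`): two representations on open unit boxes of dimensions
`m, m' ≤ 1` with integrands of KZ's rational shape (`IsRational`) and equal values are KZ-equivalent
by moves among representations of dimension `≤ 1` (`KZ.EquivalentLE 1`). Proof: both classes are mixed normal
forms (`nfD_of_isRational_one` — reduced form, the end points cost nothing by integrability —,
`nfD_of_isRational_zero`), so is their difference (`nfD_neg`, `nfD_add`), whose value vanishes; by
`nfD_eq_zero_of_eval_eq_zero` (Baker) it is a relation. Values covered: `ℚ̄ ∩ (ℚ + Σ ℚ̄ log ℚ̄ + ℚ̄π)`,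
e.g. `log 2 = ∫₀¹dx/(1+x)`, `π/4 = ∫₀¹dx/(1+x²)`. (inside the budget `relationsLE 1`) [cite: KontsevichZagier2001, §1.2 Conjecture 1] -/
theorem boxRigidityLE_of_le_one : ∀ (m m' : ℕ), m ≤ 1 → m' ≤ 1 →
    ∀ (N : KZ.IntegralRep m) (N' : KZ.IntegralRep m'),
      N.domain = {x | ∀ i, x i ∈ Set.Ioo (0:ℝ) 1} → N.IsRational →
      N'.domain = {x | ∀ i, x i ∈ Set.Ioo (0:ℝ) 1} → N'.IsRational → N.value = N'.value →
      KZ.EquivalentLE 1 N N' := by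
  classical
  obtain ⟨RA, hR⟩ := exists_carrierA
  obtain ⟨ZA, hZ⟩ := exists_ptCarrierA
  obtain ⟨RG, hRG⟩ := exists_angCarrier
  -- every rational representation on a unit box of dimension `≤ 1` is a mixed normal form
  have key : ∀ (m : ℕ), m ≤ 1 → ∀ (N : IntegralRep m), N.domain = {x | ∀ i, x i ∈ Set.Ioo (0:ℝ) 1} →
      N.IsRational →
      ∃ (r : ℝ) (k : ℕ) (u c : Fin k → ℝ) (k' : ℕ) (t d : Fin k' → ℝ), IsAlgebraic ℚ r ∧ (∀ j, 1 < u j) ∧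
        (∀ j, IsAlgebraic ℚ (u j)) ∧ (∀ j, IsAlgebraic ℚ (c j)) ∧ (∀ l, 0 ≤ t l) ∧
        (∀ l, IsAlgebraic ℚ (t l)) ∧ (∀ l, IsAlgebraic ℚ (d l)) ∧
        QuotientAddGroup.mk' (relationsLE 1) (of N) = QuotientAddGroup.mk' (relationsLE 1) (of (ZA r)) +
          ∑ j, QuotientAddGroup.mk' (relationsLE 1) (of (RA 1 (u j) (c j))) +
          ∑ l, QuotientAddGroup.mk' (relationsLE 1) (of (RG (t l) (d l))) := by
    intro m hm N hNd hN
    obtain rfl | rfl : m = 0 ∨ m = 1 := by omega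
    · refine nfD_of_isRational_zero hZ N ?_ hN
      rw [hNd]; ext x; simp
    · refine nfD_of_isRational_one hR hZ hRG N ?_ hN
      rw [hNd]; ext x; simp [Fin.forall_fin_one]
  intro m m' hm hm' N N' hNd hN hN'd hN' hv
  have hx := nfD_add hZ (key m hm N hNd hN) (nfD_neg hR hZ hRG (key m' hm' N' hN'd hN'))
  rw [← sub_eq_add_neg, ← map_sub] at hx
  obtain ⟨r, k, u, c, k', t, d, hr, hu1, hu, hc, ht0, ht, hd, hEq⟩ := hx
  have h := nfD_eq_zero_of_eval_eq_zero hR hZ hRG (of N - of N') hr hu1 hu hc ht0 ht hd hEq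
    (by rw [map_sub, eval_of, eval_of, hv, sub_self])
  exact (QuotientAddGroup.eq_zero_iff _).mp h

end Dlog


end Summit.KontsevichZagierPeriods.AbelContraction.RealHyperellipticSector.Port

end
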